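/-
Copyright: the b2b-balaban T⁴-continuum CRUX team, row NE7b OWNER lineage `t4-ne7b-p1` (gen 129). Project licence.
-/
import Mathlib.MeasureTheory.Integral.Bochner.Basic
import Mathlib.MeasureTheory.Function.L1Space.Integrable
import Mathlib.Analysis.SpecialFunctions.Pow.Real
import Mathlib.Analysis.Convex.Integral
import Mathlib.Analysis.Convex.SpecificFunctions.Basic

/-!
# THE MIXED-REGION SANDWICH: `log ∫ e^{−(A+B)} dμ` FOR A SUM OF TWO POTENTIALS IS CONTROLLED BY THE PURE INTEGRALS OF MULTIPLES OF
# `A` AND OF `B` — ABOVE by Hölder (`log∫e^{−A−B} ≤ (1∕a)log∫e^{−aA} + (1∕b)log∫e^{−bB}`, `1∕a + 1∕b = 1`), BELOW by the reversed Hölder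
# split (`log∫e^{−A−B} ≥ (1∕θ)log∫e^{−A} − ((1−θ)∕θ)log∫e^{−A+(θ∕(1−θ))B}`, `0 < θ < 1`) and by Jensen (`≥ −∫(A+B)`) — the device by which
# the small-field expansion on `S(ψ)` (where `A = Σ_{p∈S}v_p` has an `O(ε)`-precise logarithm at EVERY coupling) and the a-priori bounds on
# the large-field cells `L(ψ)` (where `B = Σ_{p∈L}v_p` has polynomial bounds for couplings of BOTH signs) are glued into ONE extensive
# two-sided bound for the fluctuation step at every external field, WITHOUT any polymer touching a hole (row NE7b, node U5c; Mathlib's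
# Hölder inequality `integral_mul_le_Lp_mul_Lq_of_nonneg` and Jensen `ConvexOn.map_integral_le` BY NAME; [folklore])

Cell `pub-balaban`, sub-cell `t4`, spine estimate NE7b (`T4WeightBudget.RelWeightBound`; the cell's OWN estimate — NOT PRINTED in
[Bałaban 1983–89], NOT PROVED).  Crux-route work under `Spine/NE7b/` by the row OWNER (`t4-ne7b-p1` gen 129, file (305)) under FREEZE
(0)'s crux-prover clause, on § [NE7bP1-G128-HANDOFF] NEXT (3)(a) («THE ASSEMBLY at one scale for ALL external fields: split
`C = S(ψ) ∪ L(ψ)`»); NOTHING of Bałaban's is named as a Lean object, valued or asserted; no `T4Continuum/Support` leaf typed; no `def`, no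
notation; zero `sorry`.  Imports (BY NAME): Mathlib only — `MeasureTheory.integral_mul_le_Lp_mul_Lq_of_nonneg` (Hölder for nonnegative real
functions), `MeasureTheory.integrable_norm_rpow_iff` (`MemLp` from integrability of the power), `MeasureTheory.integral_exp_pos`,
`ConvexOn.map_integral_le` + `convexOn_exp` (Jensen), `Real.exp_mul`, `Real.log_rpow`, `Real.log_mul`, `Real.log_le_log`.

WHY (located; the DECISION of this generation, memo `g129/records/SCOPING-d3-holes.md`).  § G128's NEXT (3)(a) asked for «the polymer gas
with large-field HOLES and a KP criterion with cell-dependent weights».  Located obstruction: at a FIXED external field `ψ` there is NO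
smallness on a hole cell (only the a-priori bounds (297), growing like `e^{κ₀'ψ²+4c₃|ψ|³}`), and under the hole-tilted reference the cells
CO-TOUCHING a hole have tilted activities that inherit this growth through the finite-range correlation of the fluctuation field — so no
Kotecký–Preiss weight absorbs them uniformly in `ψ` (a KP weight cannot absorb an `O(1)` activity: the singleton polymer alone violates the
criterion).  What the multiscale bookkeeping actually CONSUMES at the next scale is not an expansion near the holes but ONE extensive bound
`|log Z_ψ(C)| ≤ c·ε·#S(ψ) + Σ_{p∈L(ψ)}(c' + poly(ψ|_p))`, whose large-field part is then paid by the Peierls weights (294)∕(304) of the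
cells where `ψ` is large.  Hölder's inequality delivers exactly this with NO locality input: it separates `e^{−A}` (small-field cells, all
couplings `a·v` again in the road's class) from `e^{−B}` (hole cells, a-priori bounds at couplings `b` and `−θ∕(1−θ)`), and correlations
between the two regions never enter.  This file is the abstract real-analysis layer; (306) instantiates it on the road.

WHAT IS PROVED ([folklore]; `(Ω, μ)` any measure space, `A B : Ω → ℝ` measurable):
* §1 bookkeeping: `norm_exp_rpow` (`‖e^x‖^a = e^{ax}`), `exp_neg_add_eq_mul`, `memLp_exp_neg_of_integrable` (`∫e^{−aA} < ∞ ⟹ e^{−A} ∈ L^a`);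
* §2 HÖLDER ABOVE: **`integral_exp_neg_add_le`** (`∫e^{−(A+B)} ≤ (∫e^{−aA})^{1∕a}(∫e^{−bB})^{1∕b}`), `integrable_exp_neg_add`
  (`e^{−(A+B)}` integrable from the two powers), **`log_integral_exp_neg_add_le`** (`log∫e^{−(A+B)} ≤ (1∕a)log∫e^{−aA} + (1∕b)log∫e^{−bB}`);
* §3 HÖLDER BELOW: **`integral_exp_neg_le_mixed`** (`∫e^{−A} ≤ (∫e^{−(A+B)})^θ(∫e^{−(A−(θ∕(1−θ))B)})^{1−θ}`),
  **`le_log_integral_exp_neg_add`** (`(1∕θ)log∫e^{−A} − ((1−θ)∕θ)log∫e^{−(A−(θ∕(1−θ))B)} ≤ log∫e^{−(A+B)}`);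
* §4 JENSEN BELOW on a probability space: **`neg_integral_le_log_integral_exp_neg`** (`−∫(A+B) ≤ log∫e^{−(A+B)}`);
* §5 THE SANDWICH **`abs_log_integral_exp_neg_add_le`**: if `|log∫e^{−aA}| ≤ P_a`, `|log∫e^{−A}| ≤ P₁`, `log∫e^{−bB} ≤ Q_b`,
  `log∫e^{−(A−sB)} ≤ P' + Q'` (`s = θ∕(1−θ)`), then `−(P₁∕θ + ((1−θ)∕θ)(P'+Q')) ≤ log∫e^{−(A+B)} ≤ P_a∕a + Q_b∕b`; §6 toy.

HONEST (what this is NOT).  Real analysis on an abstract measure space; no Gaussian, no polymer, no field; the road instance (which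
quantities are `O(ε)·#S` and which are `Σ_L poly(ψ)`) is (306); a BOUND, not an expansion, near the holes — by the located obstruction above
no `ψ`-uniform expansion exists there at fixed `ψ`; scalar skeleton ((A3), NC-NE7b-α UNRULED); nothing of Bałaban's asserted.  BY-NAME
EFFECT ON THE WALL: NONE.  NE7b NOT PRINTED ∕ NOT PROVED; spine PROVED 0∕9; rung (B)+1 — the programme's measures remain FINITE-torus
statements; NOT the mass gap, NOT Clay.  HONEST DEPENDENCY: continuum YM on T⁴ ⇐ BetaPertH ∧ nine spine estimates (0∕9 proved); BetaPertH ⇐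
(D1) ∧ (D4) ∧ CAP+tail; G-an2-4 gates asym, D1 and NE2∕3∕4.
-/

set_option autoImplicit false

noncomputable section

namespace Summit.QuantumFields.BalabanUV.T4Continuum.NE7b.SupMixedRegionHoelder

open MeasureTheory Real
open scoped ENNReal

variable {Ω : Type*} [MeasurableSpace Ω] {μ : Measure Ω} {A B : Ω → ℝ}

/-! ## §1. Bookkeeping: powers of exponentials, `L^a` membership from integrability of the power -/

/-- `‖e^x‖^a = e^{a·x}` (real power). [folklore] -/
theorem norm_exp_rpow (x a : ℝ) : ‖exp x‖ ^ a = exp (a * x) := by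
  rw [Real.norm_of_nonneg (exp_pos x).le, ← Real.exp_mul, mul_comm]

/-- `(e^x)^a = e^{a·x}` (real power). [folklore] -/
theorem exp_rpow (x a : ℝ) : exp x ^ a = exp (a * x) := by
  rw [← Real.exp_mul, mul_comm]

omit [MeasurableSpace Ω] in
/-- `e^{−(A+B)} = e^{−A}·e^{−B}` pointwise. [folklore] -/
theorem exp_neg_add_eq_mul (A B : Ω → ℝ) :
    (fun ω => exp (-(A ω + B ω))) = fun ω => exp (-A ω) * exp (-B ω) := by
  funext ω
  rw [← exp_add]
  congr 1
  ring

/-- **`∫ e^{−aA} dμ < ∞ ⟹ e^{−A} ∈ L^a(μ)`** for measurable `A` and `0 < a`. [folklore] -/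
theorem memLp_exp_neg_of_integrable (hA : Measurable A) {a : ℝ} (ha : 0 < a)
    (hI : Integrable (fun ω => exp (-(a * A ω))) μ) :
    MemLp (fun ω => exp (-A ω)) (ENNReal.ofReal a) μ := by
  have hmeas : AEStronglyMeasurable (fun ω => exp (-A ω)) μ := (measurable_exp.comp hA.neg).aestronglyMeasurable
  refine (integrable_norm_rpow_iff hmeas (ENNReal.ofReal_pos.2 ha).ne' ENNReal.ofReal_ne_top).1 ?_
  refine hI.congr (ae_of_all _ fun ω => ?_)
  simp only [ENNReal.toReal_ofReal ha.le]
  rw [norm_exp_rpow]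
  congr 1
  ring

/-! ## §2. Hölder above -/

/-- **HÖLDER ABOVE**: for measurable `A, B`, conjugate exponents `1∕a + 1∕b = 1` and integrable `e^{−aA}`, `e^{−bB}`:
`∫ e^{−(A+B)} dμ ≤ (∫ e^{−aA} dμ)^{1∕a} · (∫ e^{−bB} dμ)^{1∕b}`. [folklore] -/
theorem integral_exp_neg_add_le (hA : Measurable A) (hB : Measurable B) {a b : ℝ} (hab : a.HolderConjugate b)
    (hIa : Integrable (fun ω => exp (-(a * A ω))) μ) (hIb : Integrable (fun ω => exp (-(b * B ω))) μ) :
    ∫ ω, exp (-(A ω + B ω)) ∂μ ≤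
      (∫ ω, exp (-(a * A ω)) ∂μ) ^ (1 / a) * (∫ ω, exp (-(b * B ω)) ∂μ) ^ (1 / b) := by
  have h := integral_mul_le_Lp_mul_Lq_of_nonneg (μ := μ) hab (f := fun ω => exp (-A ω)) (g := fun ω => exp (-B ω))
    (ae_of_all _ fun ω => (exp_pos _).le) (ae_of_all _ fun ω => (exp_pos _).le)
    (memLp_exp_neg_of_integrable hA hab.pos hIa) (memLp_exp_neg_of_integrable hB hab.symm.pos hIb)
  have hfa : (fun ω => exp (-A ω) ^ a) = fun ω => exp (-(a * A ω)) := by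
    funext ω; rw [exp_rpow]; congr 1; ring
  have hgb : (fun ω => exp (-B ω) ^ b) = fun ω => exp (-(b * B ω)) := by
    funext ω; rw [exp_rpow]; congr 1; ring
  rw [exp_neg_add_eq_mul A B]
  simpa only [hfa, hgb] using h

/-- `e^{−(A+B)}` is integrable when `e^{−aA}` and `e^{−bB}` are, for conjugate exponents (Young: `xy ≤ x^a∕a + y^b∕b`). [folklore] -/
theorem integrable_exp_neg_add (hA : Measurable A) (hB : Measurable B) {a b : ℝ} (hab : a.HolderConjugate b)
    (hIa : Integrable (fun ω => exp (-(a * A ω))) μ) (hIb : Integrable (fun ω => exp (-(b * B ω))) μ) :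
    Integrable (fun ω => exp (-(A ω + B ω))) μ := by
  have hmeas : AEStronglyMeasurable (fun ω => exp (-(A ω + B ω))) μ :=
    (measurable_exp.comp (hA.add hB).neg).aestronglyMeasurable
  refine ((hIa.div_const a).add (hIb.div_const b)).mono' hmeas (ae_of_all _ fun ω => ?_)
  rw [Real.norm_of_nonneg (exp_pos _).le]
  have hy := Real.young_inequality_of_nonneg (exp_pos (-A ω)).le (exp_pos (-B ω)).le hab
  rw [exp_rpow, exp_rpow] at hy
  have heq : exp (-(A ω + B ω)) = exp (-A ω) * exp (-B ω) := by rw [← exp_add]; congr 1; ring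
  have h1 : exp (a * -A ω) = exp (-(a * A ω)) := by congr 1; ring
  have h2 : exp (b * -B ω) = exp (-(b * B ω)) := by congr 1; ring
  rw [heq]
  rw [h1, h2] at hy
  simpa [div_eq_mul_inv, mul_comm] using hy

/-- **HÖLDER ABOVE, LOGARITHMIC FORM** (`μ ≠ 0`): `log ∫ e^{−(A+B)} ≤ (1∕a)·log ∫ e^{−aA} + (1∕b)·log ∫ e^{−bB}`. [folklore] -/
theorem log_integral_exp_neg_add_le [NeZero μ] (hA : Measurable A) (hB : Measurable B) {a b : ℝ} (hab : a.HolderConjugate b)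
    (hIa : Integrable (fun ω => exp (-(a * A ω))) μ) (hIb : Integrable (fun ω => exp (-(b * B ω))) μ) :
    log (∫ ω, exp (-(A ω + B ω)) ∂μ) ≤
      (1 / a) * log (∫ ω, exp (-(a * A ω)) ∂μ) + (1 / b) * log (∫ ω, exp (-(b * B ω)) ∂μ) := by
  have hZ : 0 < ∫ ω, exp (-(A ω + B ω)) ∂μ := integral_exp_pos (integrable_exp_neg_add hA hB hab hIa hIb)
  have hZa : 0 < ∫ ω, exp (-(a * A ω)) ∂μ := integral_exp_pos hIa
  have hZb : 0 < ∫ ω, exp (-(b * B ω)) ∂μ := integral_exp_pos hIb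
  have h := log_le_log hZ (integral_exp_neg_add_le hA hB hab hIa hIb)
  rwa [log_mul (rpow_pos_of_pos hZa _).ne' (rpow_pos_of_pos hZb _).ne', log_rpow hZa, log_rpow hZb] at h

/-! ## §3. Hölder below (the reversed split) -/

/-- **HÖLDER BELOW**: for measurable `A, B`, `0 < θ < 1`, and integrable `e^{−(A+B)}`, `e^{−(A − (θ∕(1−θ))B)}`:
`∫ e^{−A} dμ ≤ (∫ e^{−(A+B)} dμ)^θ · (∫ e^{−(A − (θ∕(1−θ))B)} dμ)^{1−θ}`
(Hölder with exponents `1∕θ`, `1∕(1−θ)` for `e^{−A} = (e^{−(A+B)})^θ · (e^{−(A−(θ∕(1−θ))B)})^{1−θ}`). [folklore] -/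
theorem integral_exp_neg_le_mixed (hA : Measurable A) (hB : Measurable B) {θ : ℝ} (hθ0 : 0 < θ) (hθ1 : θ < 1)
    (hI : Integrable (fun ω => exp (-(A ω + B ω))) μ)
    (hI' : Integrable (fun ω => exp (-(A ω - θ / (1 - θ) * B ω))) μ) :
    ∫ ω, exp (-A ω) ∂μ ≤
      (∫ ω, exp (-(A ω + B ω)) ∂μ) ^ θ * (∫ ω, exp (-(A ω - θ / (1 - θ) * B ω)) ∂μ) ^ (1 - θ) := by
  have h1θ : 0 < 1 - θ := by linarith
  have hpq : (θ⁻¹).HolderConjugate (1 - θ)⁻¹ := Real.HolderConjugate.inv_one_sub_inv hθ0 hθ1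
  -- the two factors
  set F : Ω → ℝ := fun ω => exp (-(θ * (A ω + B ω))) with hF
  set G : Ω → ℝ := fun ω => exp (-((1 - θ) * (A ω - θ / (1 - θ) * B ω))) with hG
  have hFm : Measurable fun ω => θ * (A ω + B ω) := (hA.add hB).const_mul θ
  have hGm : Measurable fun ω => (1 - θ) * (A ω - θ / (1 - θ) * B ω) := (hA.sub (hB.const_mul _)).const_mul _
  have hIF : Integrable (fun ω => exp (-(θ⁻¹ * (θ * (A ω + B ω))))) μ := by
    refine hI.congr (ae_of_all _ fun ω => ?_)
    simp only
    rw [← mul_assoc, inv_mul_cancel₀ hθ0.ne', one_mul]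
  have hIG : Integrable (fun ω => exp (-((1 - θ)⁻¹ * ((1 - θ) * (A ω - θ / (1 - θ) * B ω))))) μ := by
    refine hI'.congr (ae_of_all _ fun ω => ?_)
    simp only
    rw [← mul_assoc, inv_mul_cancel₀ h1θ.ne', one_mul]
  have h := integral_exp_neg_add_le (μ := μ) hFm hGm hpq hIF hIG
  -- the product is `e^{−A}`
  have hprod : ∀ ω, exp (-(θ * (A ω + B ω) + (1 - θ) * (A ω - θ / (1 - θ) * B ω))) = exp (-A ω) := by
    intro ω
    congr 1
    field_simp
    ring
  have hlhs : ∫ ω, exp (-(θ * (A ω + B ω) + (1 - θ) * (A ω - θ / (1 - θ) * B ω))) ∂μ = ∫ ω, exp (-A ω) ∂μ :=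
    integral_congr_ae (ae_of_all _ hprod)
  have hr1 : ∫ ω, exp (-(θ⁻¹ * (θ * (A ω + B ω)))) ∂μ = ∫ ω, exp (-(A ω + B ω)) ∂μ :=
    integral_congr_ae (ae_of_all _ fun ω => by dsimp only; rw [← mul_assoc, inv_mul_cancel₀ hθ0.ne', one_mul])
  have hr2 : ∫ ω, exp (-((1 - θ)⁻¹ * ((1 - θ) * (A ω - θ / (1 - θ) * B ω)))) ∂μ =
      ∫ ω, exp (-(A ω - θ / (1 - θ) * B ω)) ∂μ :=
    integral_congr_ae (ae_of_all _ fun ω => by dsimp only; rw [← mul_assoc, inv_mul_cancel₀ h1θ.ne', one_mul])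
  rw [hlhs, hr1, hr2, one_div, one_div, inv_inv, inv_inv] at h
  exact h

/-- **HÖLDER BELOW, LOGARITHMIC FORM** (`μ ≠ 0`, `e^{−A}` integrable): with `s = θ∕(1−θ)`,
`(1∕θ)·log ∫ e^{−A} − ((1−θ)∕θ)·log ∫ e^{−(A − sB)} ≤ log ∫ e^{−(A+B)}`. [folklore] -/
theorem le_log_integral_exp_neg_add [NeZero μ] (hA : Measurable A) (hB : Measurable B) {θ : ℝ} (hθ0 : 0 < θ) (hθ1 : θ < 1)
    (hI0 : Integrable (fun ω => exp (-A ω)) μ) (hI : Integrable (fun ω => exp (-(A ω + B ω))) μ)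
    (hI' : Integrable (fun ω => exp (-(A ω - θ / (1 - θ) * B ω))) μ) :
    (1 / θ) * log (∫ ω, exp (-A ω) ∂μ) - ((1 - θ) / θ) * log (∫ ω, exp (-(A ω - θ / (1 - θ) * B ω)) ∂μ) ≤
      log (∫ ω, exp (-(A ω + B ω)) ∂μ) := by
  have h1θ : 0 < 1 - θ := by linarith
  have hZ0 : 0 < ∫ ω, exp (-A ω) ∂μ := integral_exp_pos hI0
  have hZ : 0 < ∫ ω, exp (-(A ω + B ω)) ∂μ := integral_exp_pos hI
  have hZ' : 0 < ∫ ω, exp (-(A ω - θ / (1 - θ) * B ω)) ∂μ := integral_exp_pos hI'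
  have h := log_le_log hZ0 (integral_exp_neg_le_mixed hA hB hθ0 hθ1 hI hI')
  rw [log_mul (rpow_pos_of_pos hZ _).ne' (rpow_pos_of_pos hZ' _).ne', log_rpow hZ, log_rpow hZ'] at h
  -- divide by `θ`
  have h' : log (∫ ω, exp (-A ω) ∂μ) / θ ≤
      log (∫ ω, exp (-(A ω + B ω)) ∂μ) + (1 - θ) / θ * log (∫ ω, exp (-(A ω - θ / (1 - θ) * B ω)) ∂μ) := by
    rw [div_le_iff₀ hθ0]
    have : (log (∫ ω, exp (-(A ω + B ω)) ∂μ) + (1 - θ) / θ * log (∫ ω, exp (-(A ω - θ / (1 - θ) * B ω)) ∂μ)) * θ =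
        θ * log (∫ ω, exp (-(A ω + B ω)) ∂μ) + (1 - θ) * log (∫ ω, exp (-(A ω - θ / (1 - θ) * B ω)) ∂μ) := by
      field_simp
    rw [this]
    exact h
  rw [one_div_mul_eq_div]
  linarith

/-! ## §4. Jensen below (probability space) -/

/-- **JENSEN BELOW**: on a probability space, for integrable `A + B` with integrable `e^{−(A+B)}`: `−∫(A+B) dμ ≤ log ∫ e^{−(A+B)} dμ`.
[folklore] -/
theorem neg_integral_le_log_integral_exp_neg [IsProbabilityMeasure μ] (hAB : Integrable (fun ω => A ω + B ω) μ)
    (hI : Integrable (fun ω => exp (-(A ω + B ω))) μ) :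
    -(∫ ω, (A ω + B ω) ∂μ) ≤ log (∫ ω, exp (-(A ω + B ω)) ∂μ) := by
  have hJ := ConvexOn.map_integral_le (μ := μ) (f := fun ω => -(A ω + B ω)) convexOn_exp continuous_exp.continuousOn
    isClosed_univ (ae_of_all _ fun _ => Set.mem_univ _) hAB.neg hI
  rw [integral_neg] at hJ
  have hZ : 0 < ∫ ω, exp (-(A ω + B ω)) ∂μ := integral_exp_pos hI
  calc -(∫ ω, (A ω + B ω) ∂μ) = log (exp (-(∫ ω, (A ω + B ω) ∂μ))) := (log_exp _).symm
    _ ≤ log (∫ ω, exp (-(A ω + B ω)) ∂μ) := log_le_log (exp_pos _) hJ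

/-! ## §5. The sandwich -/

/-- **THE MIXED-REGION SANDWICH.**  On a nonzero measure space let `A, B` be measurable with `e^{−aA}`, `e^{−bB}` integrable for conjugate
`a, b` (`1∕a + 1∕b = 1`), `e^{−A}` and `e^{−(A − sB)}` integrable (`s = θ∕(1−θ)`, `0 < θ < 1`), and suppose the PURE quantities are
controlled: `log ∫e^{−aA} ≤ Pa`, `−P₁ ≤ log ∫e^{−A}`, `log ∫e^{−bB} ≤ Qb`, `log ∫e^{−(A−sB)} ≤ M`.  Then
`−(P₁∕θ + ((1−θ)∕θ)·M) ≤ log ∫ e^{−(A+B)} ≤ Pa∕a + Qb∕b`. [folklore] -/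
theorem log_integral_exp_neg_add_mem [NeZero μ] (hA : Measurable A) (hB : Measurable B) {a b θ : ℝ} (hab : a.HolderConjugate b)
    (hθ0 : 0 < θ) (hθ1 : θ < 1) (hIa : Integrable (fun ω => exp (-(a * A ω))) μ)
    (hIb : Integrable (fun ω => exp (-(b * B ω))) μ) (hI0 : Integrable (fun ω => exp (-A ω)) μ)
    (hI' : Integrable (fun ω => exp (-(A ω - θ / (1 - θ) * B ω))) μ) {Pa P₁ Qb M : ℝ}
    (hPa : log (∫ ω, exp (-(a * A ω)) ∂μ) ≤ Pa) (hP₁ : -P₁ ≤ log (∫ ω, exp (-A ω) ∂μ))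
    (hQb : log (∫ ω, exp (-(b * B ω)) ∂μ) ≤ Qb) (hM : log (∫ ω, exp (-(A ω - θ / (1 - θ) * B ω)) ∂μ) ≤ M) :
    -(P₁ / θ + (1 - θ) / θ * M) ≤ log (∫ ω, exp (-(A ω + B ω)) ∂μ) ∧
      log (∫ ω, exp (-(A ω + B ω)) ∂μ) ≤ Pa / a + Qb / b := by
  have h1θ : 0 < 1 - θ := by linarith
  constructor
  · have hlow := le_log_integral_exp_neg_add hA hB hθ0 hθ1 hI0 (integrable_exp_neg_add hA hB hab hIa hIb) hI'
    have h1 : (1 / θ) * (-P₁) ≤ (1 / θ) * log (∫ ω, exp (-A ω) ∂μ) := mul_le_mul_of_nonneg_left hP₁ (by positivity)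
    have h2 : (1 - θ) / θ * log (∫ ω, exp (-(A ω - θ / (1 - θ) * B ω)) ∂μ) ≤ (1 - θ) / θ * M :=
      mul_le_mul_of_nonneg_left hM (by positivity)
    have heq : -(P₁ / θ + (1 - θ) / θ * M) = (1 / θ) * (-P₁) - (1 - θ) / θ * M := by ring
    rw [heq]
    linarith
  · have hup := log_integral_exp_neg_add_le hA hB hab hIa hIb
    have h1 : (1 / a) * log (∫ ω, exp (-(a * A ω)) ∂μ) ≤ (1 / a) * Pa :=
      mul_le_mul_of_nonneg_left hPa (by have := hab.pos; positivity)
    have h2 : (1 / b) * log (∫ ω, exp (-(b * B ω)) ∂μ) ≤ (1 / b) * Qb :=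
      mul_le_mul_of_nonneg_left hQb (by have := hab.symm.pos; positivity)
    have heq : Pa / a + Qb / b = (1 / a) * Pa + (1 / b) * Qb := by ring
    rw [heq]
    linarith

/-- **THE SANDWICH IN ABSOLUTE VALUE**: with the four pure controls as above and all budgets nonnegative,
`|log ∫ e^{−(A+B)}| ≤ max(Pa∕a + Qb∕b, P₁∕θ + ((1−θ)∕θ)·M)`. [folklore] -/
theorem abs_log_integral_exp_neg_add_le [NeZero μ] (hA : Measurable A) (hB : Measurable B) {a b θ : ℝ} (hab : a.HolderConjugate b)
    (hθ0 : 0 < θ) (hθ1 : θ < 1) (hIa : Integrable (fun ω => exp (-(a * A ω))) μ)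
    (hIb : Integrable (fun ω => exp (-(b * B ω))) μ) (hI0 : Integrable (fun ω => exp (-A ω)) μ)
    (hI' : Integrable (fun ω => exp (-(A ω - θ / (1 - θ) * B ω))) μ) {Pa P₁ Qb M : ℝ}
    (hPa : log (∫ ω, exp (-(a * A ω)) ∂μ) ≤ Pa) (hP₁ : -P₁ ≤ log (∫ ω, exp (-A ω) ∂μ))
    (hQb : log (∫ ω, exp (-(b * B ω)) ∂μ) ≤ Qb) (hM : log (∫ ω, exp (-(A ω - θ / (1 - θ) * B ω)) ∂μ) ≤ M) :
    |log (∫ ω, exp (-(A ω + B ω)) ∂μ)| ≤ max (Pa / a + Qb / b) (P₁ / θ + (1 - θ) / θ * M) := by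
  obtain ⟨hlow, hup⟩ := log_integral_exp_neg_add_mem hA hB hab hθ0 hθ1 hIa hIb hI0 hI' hPa hP₁ hQb hM
  rw [abs_le]
  constructor
  · exact le_trans (neg_le_neg (le_max_right _ _)) hlow
  · exact hup.trans (le_max_left _ _)

/-! ## §6. Toy -/

/-- Toy (§1): `‖e^0‖^2 = e^{2·0}`. -/
example : ‖exp 0‖ ^ (2 : ℝ) = exp (2 * 0) := norm_exp_rpow 0 2

end Summit.QuantumFields.BalabanUV.T4Continuum.NE7b.SupMixedRegionHoelder
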